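import Summits.AtomisticToContinuum.Crystallization.Theorems.FrustratedLawDichotomyStrainedPatchHomConvexWell
import Summits.AtomisticToContinuum.Crystallization.Theorems.FrustratedLawDichotomyStrainedPatchTaylorChord
import Summits.AtomisticToContinuum.Crystallization.Theorems.FrustratedLawDichotomyStrainedPatchHomSplit

/-!
# Uniform convexity of a LABEL SUM of `C^{1,1}` pair terms along a segment (real side of the `λ`-leaf of lever (C))

decomp-a2c hand-1 g26 (crux `AperiodicFrustratedLawGap`, stmt-AtomisticToContinuum-27623; `(H) HomFloor (1/625)`, hcp half; critic row 1026 (C):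
«the λ-certificate over the (U, ξ)-box is the open kernel item of (C)»).  `…HomConvexWell.floor_of_uniformlyConvex_segment` turns certified data
(value `V`, slope `G`, uniform convexity `λ` along every segment) into the energy floor `V − G²/(2λ)` on a whole ball; its convexity hypothesis is the
MONOTONE-SLOPE form `g′ t ≥ g′ 0 + κ t`.  The potential of record `W₄₅` is only `C^{1,1}` (the second derivative jumps at `r = 3`, `9/2`), so that form
must come from a PIECEWISE-`C²` argument.  This file proves it for a SUM over labels of terms `W‖p_i + sΔ‖` sharing the direction `Δ`, with a SIGNED
curvature floor `κ` — the generalisation of lens-5's one-term, symmetric-`K` chord lemma `…TaylorChord.chordC11_holds`, whose segment calculus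
(`segR/segN/segS/segG/segGd/segExc`, `mem_segExc`, `hasDerivAt_segR/segS`, `hasDerivAt_chordG`) is reused verbatim:

* §1 `monotoneOn_of_deriv_nonneg_off` — generic: continuous on `[x, y]`, derivative `≥ 0` off a FINITE set ⟹ monotone (induction on the exceptional points);
* §2 `hasDerivAt_segG'` (`G′ = segGd` at good parameters, no size hypothesis), continuity of `Σ segG`;
* §3 ★★ `slope_growth_of_curvature_sum` — tube `a ≤ ‖p_i + sΔ‖ ≤ b` (`a > 0`), `W′ = W₁` on `[a,b]`, `W₁` continuous, `W₁′` exists off the finite kink set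
  `J`, and the CURVATURE-SUM floor `κ ≤ Σ_i segGd W₁ (p i) Δ s` at every good parameter ⟹ `Σ_i segG (p i) 0 + κ s ≤ Σ_i segG (p i) s` on `[0,1]`,
  together with `HasDerivAt (s ↦ Σ_i W‖p_i + sΔ‖) (Σ_i segG … s) s` — exactly the `hg`/`hmono` inputs of `…HomConvexWell`;
* §4 ★★★ `sum_floor_of_curvature` — the two files combined: `V ≤ Σ_i W‖p_i‖`, `|Σ_i segG … 0| ≤ G‖Δ‖`, `κ = λ‖Δ‖²`, `0 < λ` ⟹ `V − G²/(2λ) ≤ Σ_i W‖p_i + Δ‖`.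
  (For the hcp box sum: `p_b = latPt U hexFrame b + U(hcpShift + ξ₀)`, `Δ = U(ξ − ξ₀)`; `segGd` summed over labels is the quadratic form of the
  ξ-Hessian `Uᵀ[Σ_b W″ĉĉᵀ + (W′/r)(1 − ĉĉᵀ)]U`, which the kernel leaf encloses and tests `⪰ λ`.)

NO definitions; 0 sorry; standard axioms; no instances / notation / `#eval`.  `--supports stmt-AtomisticToContinuum-27623`.
-/

noncomputable section

namespace Summit.AtomisticToContinuum.Crystallization.Theorems.FrustratedLawDichotomyStrainedPatchHomConvexSegment

open scoped BigOperators
open Summit.AtomisticToContinuum.Crystallization.Theorems.FrustratedLawDichotomyStrainedPatchTaylorChord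
  (segR segN segS segG segGd segExc segR_continuous segN_eq_inner mem_segExc hasDerivAt_segR hasDerivAt_segS hasDerivAt_chordG segS_sq_le)
open Summit.AtomisticToContinuum.Crystallization.Theorems.FrustratedLawDichotomyStrainedPatchHomConvexWell (floor_of_uniformlyConvex_segment)
open Summit.AtomisticToContinuum.Crystallization.Theorems.ChargedEnergyGapNegative (E3)
open Summit.AtomisticToContinuum.Crystallization.Theorems.FrustratedLawDichotomyStrainedPatchHomSplit (latPt hexFrame hcpShift)

/-! ## §1. Monotonicity from a derivative sign off a finite set -/

/-- One exception-free piece: continuous on `[u, v]`, `HasDerivAt h (h′ t) t` with `0 ≤ h′ t` at every `t ∈ (u, v)` ⟹ `h u ≤ h v`. [folklore] -/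
theorem le_of_deriv_nonneg_piece {h h' : ℝ → ℝ} {u v : ℝ} (huv : u ≤ v) (hcont : ContinuousOn h (Set.Icc u v))
    (hder : ∀ t ∈ Set.Ioo u v, HasDerivAt h (h' t) t) (hnn : ∀ t ∈ Set.Ioo u v, 0 ≤ h' t) : h u ≤ h v := by
  have hmono : MonotoneOn h (Set.Icc u v) := by
    refine monotoneOn_of_hasDerivWithinAt_nonneg (convex_Icc u v) hcont (f' := h') ?_ ?_
    · intro t ht; rw [interior_Icc] at ht; exact (hder t ht).hasDerivWithinAt
    · intro t ht; rw [interior_Icc] at ht; exact hnn t ht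
  exact hmono (Set.left_mem_Icc.2 huv) (Set.right_mem_Icc.2 huv) huv

/-- ★ **Monotonicity off a finite set**: `h` continuous on `[x, y]`, differentiable with derivative `≥ 0` at every point of `(x, y)` outside the finite
set `X` ⟹ `h u ≤ h v` for all `x ≤ u ≤ v ≤ y` (induction on the number of exceptional points strictly between `u` and `v`; the template is
`…TaylorChord.chordH_le`). [folklore] -/
theorem monotoneOn_of_deriv_nonneg_off {h h' : ℝ → ℝ} {x y : ℝ} (X : Finset ℝ) (hcont : ContinuousOn h (Set.Icc x y))
    (hder : ∀ t ∈ Set.Ioo x y, t ∉ X → HasDerivAt h (h' t) t) (hnn : ∀ t ∈ Set.Ioo x y, t ∉ X → 0 ≤ h' t) :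
    ∀ u v : ℝ, x ≤ u → v ≤ y → u ≤ v → h u ≤ h v := by
  classical
  -- exception-free pieces
  have piece : ∀ u v : ℝ, x ≤ u → v ≤ y → u ≤ v → (∀ t ∈ X, ¬(u < t ∧ t < v)) → h u ≤ h v := by
    intro u v hu hv huv hfree
    have hsub : Set.Ioo u v ⊆ Set.Ioo x y := Set.Ioo_subset_Ioo hu hv
    have hoff : ∀ t ∈ Set.Ioo u v, t ∉ X := fun t ht htX => hfree t htX ht
    exact le_of_deriv_nonneg_piece huv (hcont.mono (Set.Icc_subset_Icc hu hv)) (fun t ht => hder t (hsub ht) (hoff t ht))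
      fun t ht => hnn t (hsub ht) (hoff t ht)
  -- induction on the number of exceptional points strictly inside
  have main : ∀ n : ℕ, ∀ u v : ℝ, x ≤ u → v ≤ y → u ≤ v → (X.filter (fun t => u < t ∧ t < v)).card ≤ n → h u ≤ h v := by
    intro n
    induction n with
    | zero =>
      intro u v hu hv huv hcard
      have hemp := Finset.card_eq_zero.1 (Nat.le_zero.1 hcard)
      refine piece u v hu hv huv fun t ht hut => ?_
      have : t ∈ X.filter (fun t => u < t ∧ t < v) := Finset.mem_filter.2 ⟨ht, hut⟩
      rw [hemp] at this
      exact absurd this (Finset.notMem_empty t)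
    | succ n ih =>
      intro u v hu hv huv hcard
      by_cases hex : ∃ t ∈ X, u < t ∧ t < v
      · obtain ⟨t, ht, hut, htv⟩ := hex
        set T := X.filter (fun t => u < t ∧ t < v) with hT
        have htT : t ∈ T := Finset.mem_filter.2 ⟨ht, hut, htv⟩
        have hc1 : (X.filter (fun w => u < w ∧ w < t)).card ≤ n := by
          have hsub : X.filter (fun w => u < w ∧ w < t) ⊆ T.erase t := by
            intro w hw
            obtain ⟨hw1, hw2, hw3⟩ := Finset.mem_filter.1 hw
            exact Finset.mem_erase.2 ⟨hw3.ne, Finset.mem_filter.2 ⟨hw1, hw2, hw3.trans htv⟩⟩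
          have := Finset.card_le_card hsub
          rw [Finset.card_erase_of_mem htT] at this
          omega
        have hc2 : (X.filter (fun w => t < w ∧ w < v)).card ≤ n := by
          have hsub : X.filter (fun w => t < w ∧ w < v) ⊆ T.erase t := by
            intro w hw
            obtain ⟨hw1, hw2, hw3⟩ := Finset.mem_filter.1 hw
            exact Finset.mem_erase.2 ⟨hw2.ne', Finset.mem_filter.2 ⟨hw1, hut.trans hw2, hw3⟩⟩
          have := Finset.card_le_card hsub
          rw [Finset.card_erase_of_mem htT] at this
          omega
        exact (ih u t hu (htv.le.trans hv) hut.le hc1).trans (ih t v (hu.trans hut.le) hv htv.le hc2)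
      · exact piece u v hu hv huv fun t ht hut => hex ⟨t, ht, hut⟩
  intro u v hu hv huv
  exact main _ u v hu hv huv le_rfl

/-! ## §2. The slope term `G = W₁(ρ)σ` and its derivative at good parameters -/

/-- `G′ = segGd` wherever `W₁` is differentiable at `ρ(s) ≠ 0` (no size hypothesis; cf. `…TaylorChord.hasDerivAt_chordH`). [folklore] -/
theorem hasDerivAt_segG' {W₁ : ℝ → ℝ} {p Δ : EuclideanSpace ℝ (Fin 3)} {s : ℝ} (h0 : segR p Δ s ≠ 0)
    (hd : HasDerivAt W₁ (deriv W₁ (segR p Δ s)) (segR p Δ s)) : HasDerivAt (segG W₁ p Δ) (segGd W₁ p Δ s) s := by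
  have hA : HasDerivAt (fun y => W₁ (segR p Δ y)) (deriv W₁ (segR p Δ s) * segS p Δ s) s := hd.comp s (hasDerivAt_segR h0)
  exact hA.mul (hasDerivAt_segS h0)

/-- Continuity of `G = W₁(ρ)σ` on `[0,1]` inside the tube. [folklore] -/
theorem continuousOn_segG {W₁ : ℝ → ℝ} {a b : ℝ} {p Δ : EuclideanSpace ℝ (Fin 3)} (hcont : ContinuousOn W₁ (Set.Icc a b)) (ha : 0 < a)
    (htube : ∀ s ∈ Set.Icc (0 : ℝ) 1, a ≤ ‖p + s • Δ‖ ∧ ‖p + s • Δ‖ ≤ b) : ContinuousOn (segG W₁ p Δ) (Set.Icc 0 1) := by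
  have hρ : ContinuousOn (segR p Δ) (Set.Icc 0 1) := (segR_continuous p Δ).continuousOn
  have hWρ : ContinuousOn (fun s => W₁ (segR p Δ s)) (Set.Icc 0 1) := hcont.comp hρ fun s hs => ⟨(htube s hs).1, (htube s hs).2⟩
  have hN : ContinuousOn (segN p Δ) (Set.Icc 0 1) := by unfold segN; fun_prop
  have hσ : ContinuousOn (segS p Δ) (Set.Icc 0 1) := hN.div hρ fun s hs => (ha.trans_le (htube s hs).1).ne'
  unfold segG
  exact hWρ.mul hσ

/-! ## §3. ★★ Slope growth of the label sum from a curvature-sum floor -/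

/-- ★★ **SLOPE GROWTH FROM A CURVATURE-SUM FLOOR** (piecewise `C²`, finitely many labels sharing the direction `Δ ≠ 0`).  Tube `a ≤ ‖p_i + sΔ‖ ≤ b`
(`a > 0`) for `s ∈ [0,1]`; `W′ = W₁` on `[a, b]`; `W₁` continuous on `[a, b]` and differentiable on `(a, b) ∖ J` (`J` finite: the kinks); and at every
parameter `s ∈ (0,1)` at which ALL radii avoid `{a, b} ∪ J` the curvature sum is `≥ κ`: `κ ≤ Σ_i segGd W₁ (p i) Δ s`
(`segGd = W₁′(ρ)σ² + W₁(ρ)(‖Δ‖² − σ²)/ρ`).  THEN the slope `s ↦ Σ_i segG W₁ (p i) Δ s` grows at rate `≥ κ`: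
`Σ_i segG … 0 + κ s ≤ Σ_i segG … s` on `[0,1]`. [folklore: §1 applied to `Σ segG − κ·id`, exceptional parameters `⋃_i segExc`] -/
theorem slope_growth_of_curvature_sum {ι : Type*} (S : Finset ι) (p : ι → EuclideanSpace ℝ (Fin 3)) {Δ : EuclideanSpace ℝ (Fin 3)} (hΔ : Δ ≠ 0)
    {W₁ : ℝ → ℝ} (J : Finset ℝ) {a b κ : ℝ} (ha : 0 < a) (hcont : ContinuousOn W₁ (Set.Icc a b))
    (hdiff : ∀ r, a < r → r < b → r ∉ J → HasDerivAt W₁ (deriv W₁ r) r)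
    (htube : ∀ i ∈ S, ∀ s ∈ Set.Icc (0 : ℝ) 1, a ≤ ‖p i + s • Δ‖ ∧ ‖p i + s • Δ‖ ≤ b)
    (hcurv : ∀ s ∈ Set.Ioo (0 : ℝ) 1, (∀ i ∈ S, a < segR (p i) Δ s ∧ segR (p i) Δ s < b ∧ segR (p i) Δ s ∉ J) →
      κ ≤ ∑ i ∈ S, segGd W₁ (p i) Δ s) :
    ∀ s ∈ Set.Icc (0 : ℝ) 1, ∑ i ∈ S, segG W₁ (p i) Δ 0 + κ * s ≤ ∑ i ∈ S, segG W₁ (p i) Δ s := by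
  classical
  set h : ℝ → ℝ := fun s => ∑ i ∈ S, segG W₁ (p i) Δ s - κ * s with hh
  set X : Finset ℝ := S.biUnion (fun i => segExc (p i) Δ (insert a (insert b J))) with hX
  -- good parameters: every radius avoids `{a, b} ∪ J`
  have good : ∀ s ∈ Set.Ioo (0 : ℝ) 1, s ∉ X → ∀ i ∈ S, a < segR (p i) Δ s ∧ segR (p i) Δ s < b ∧ segR (p i) Δ s ∉ J := by
    intro s hs hsX i hi
    have hnot : segR (p i) Δ s ∉ insert a (insert b J) := fun hmem =>
      hsX (Finset.mem_biUnion.2 ⟨i, hi, mem_segExc hΔ hmem⟩)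
    simp only [Finset.mem_insert, not_or] at hnot
    obtain ⟨hna, hnb, hnJ⟩ := hnot
    have ht := htube i hi s (Set.Ioo_subset_Icc_self hs)
    exact ⟨lt_of_le_of_ne ht.1 (Ne.symm hna), lt_of_le_of_ne ht.2 hnb, hnJ⟩
  have hcontH : ContinuousOn h (Set.Icc 0 1) := by
    have h1 : ContinuousOn (fun s => ∑ i ∈ S, segG W₁ (p i) Δ s) (Set.Icc 0 1) :=
      continuousOn_finsetSum S fun i hi => continuousOn_segG hcont ha (htube i hi)
    exact h1.sub (by fun_prop)
  have hderH : ∀ s ∈ Set.Ioo (0 : ℝ) 1, s ∉ X → HasDerivAt h (∑ i ∈ S, segGd W₁ (p i) Δ s - κ) s := by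
    intro s hs hsX
    have hg := good s hs hsX
    have hsum : HasDerivAt (fun t => ∑ i ∈ S, segG W₁ (p i) Δ t) (∑ i ∈ S, segGd W₁ (p i) Δ s) s := by
      refine HasDerivAt.fun_sum fun i hi => ?_
      obtain ⟨h1, h2, h3⟩ := hg i hi
      exact hasDerivAt_segG' (ha.trans h1).ne' (hdiff _ h1 h2 h3)
    have hl : HasDerivAt (fun t : ℝ => κ * t) (κ * 1) s := (hasDerivAt_id s).const_mul κ
    exact (hsum.sub hl).congr_deriv (by rw [mul_one])
  have hnn : ∀ s ∈ Set.Ioo (0 : ℝ) 1, s ∉ X → 0 ≤ ∑ i ∈ S, segGd W₁ (p i) Δ s - κ :=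
    fun s hs hsX => sub_nonneg.2 (hcurv s hs (good s hs hsX))
  intro s hs
  have hmono := monotoneOn_of_deriv_nonneg_off X hcontH hderH hnn 0 s le_rfl hs.2 hs.1
  simp only [hh, mul_zero, sub_zero] at hmono
  linarith

/-- ★ The label sum is differentiable along the segment with derivative `Σ_i segG` (inside the tube). [folklore] -/
theorem hasDerivAt_sum_segment {ι : Type*} (S : Finset ι) (p : ι → EuclideanSpace ℝ (Fin 3)) (Δ : EuclideanSpace ℝ (Fin 3))
    {W W₁ : ℝ → ℝ} {a b : ℝ} (ha : 0 < a) (hW : ∀ r, a ≤ r → r ≤ b → HasDerivAt W (W₁ r) r)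
    (htube : ∀ i ∈ S, ∀ s ∈ Set.Icc (0 : ℝ) 1, a ≤ ‖p i + s • Δ‖ ∧ ‖p i + s • Δ‖ ≤ b) {s : ℝ} (hs : s ∈ Set.Icc (0 : ℝ) 1) :
    HasDerivAt (fun t : ℝ => ∑ i ∈ S, W ‖p i + t • Δ‖) (∑ i ∈ S, segG W₁ (p i) Δ s) s := by
  refine HasDerivAt.fun_sum fun i hi => ?_
  have ht := htube i hi s hs
  exact hasDerivAt_chordG hW ha (s := s) ht.1 ht.2

/-! ## §4. ★★★ The floor of the label sum on the segment end point -/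

/-- ★★★ **ENERGY FLOOR FROM VALUE, SLOPE AND CURVATURE-SUM DATA** (`…HomConvexWell` ∘ §3).  With the hypotheses of
`slope_growth_of_curvature_sum` for `κ = λ‖Δ‖²`, `0 < λ`, a value bound `V ≤ Σ_i W‖p_i‖` and a slope bound `|Σ_i segG W₁ (p i) Δ 0| ≤ G‖Δ‖`:
`V − G²/(2λ) ≤ Σ_i W‖p_i + Δ‖`.  (The `λ`-leaf certifies `V`, `G`, `λ` over its `U`-box for every `Δ = U(ξ − ξ₀)` in the ball.) [folklore chaining] -/
theorem sum_floor_of_curvature {ι : Type*} (S : Finset ι) (p : ι → EuclideanSpace ℝ (Fin 3)) {Δ : EuclideanSpace ℝ (Fin 3)} (hΔ : Δ ≠ 0)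
    {W W₁ : ℝ → ℝ} (J : Finset ℝ) {a b lam G V : ℝ} (ha : 0 < a) (hlam : 0 < lam)
    (hW : ∀ r, a ≤ r → r ≤ b → HasDerivAt W (W₁ r) r) (hcont : ContinuousOn W₁ (Set.Icc a b))
    (hdiff : ∀ r, a < r → r < b → r ∉ J → HasDerivAt W₁ (deriv W₁ r) r)
    (htube : ∀ i ∈ S, ∀ s ∈ Set.Icc (0 : ℝ) 1, a ≤ ‖p i + s • Δ‖ ∧ ‖p i + s • Δ‖ ≤ b)
    (hcurv : ∀ s ∈ Set.Ioo (0 : ℝ) 1, (∀ i ∈ S, a < segR (p i) Δ s ∧ segR (p i) Δ s < b ∧ segR (p i) Δ s ∉ J) →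
      lam * ‖Δ‖ ^ 2 ≤ ∑ i ∈ S, segGd W₁ (p i) Δ s)
    (hV : V ≤ ∑ i ∈ S, W ‖p i‖) (hG : |∑ i ∈ S, segG W₁ (p i) Δ 0| ≤ G * ‖Δ‖) :
    V - G ^ 2 / (2 * lam) ≤ ∑ i ∈ S, W ‖p i + Δ‖ := by
  have hmono := slope_growth_of_curvature_sum S p hΔ J ha hcont hdiff htube hcurv
  have hV' : V ≤ (fun x : EuclideanSpace ℝ (Fin 3) => ∑ i ∈ S, W ‖p i + x‖) 0 := by simpa using hV
  have key := floor_of_uniformlyConvex_segment (f := fun x : EuclideanSpace ℝ (Fin 3) => ∑ i ∈ S, W ‖p i + x‖) (x₀ := 0) (v := Δ)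
    (g' := fun s => ∑ i ∈ S, segG W₁ (p i) Δ s) hlam hV'
    (fun s hs => by simpa using hasDerivAt_sum_segment S p Δ ha hW htube hs)
    (fun s hs => by have := hmono s hs; linarith) hG
  simpa using key

/-! ## §5. ★★★ The hcp B-sublattice sum: the whole ξ-ball from data at one shuffle `ξ₀` -/

/-- ★★★ **ξ-ELIMINATION FOR THE hcp SHIFTED-FAMILY SUM** (the `(H)` certificate's energy disjunct, B-family part; any pair potential `W` with the
piecewise-`C²` data of §3, any label finset `B`).  Fix the entries `U` and a reference shuffle `ξ₀`; put `p_b := latPt U hexFrame b + U(hcpShift + ξ₀)` and,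
for the target shuffle `ξ`, `Δ := U(ξ − ξ₀)` (so `p_b + Δ = latPt U hexFrame b + U(hcpShift + ξ)`).  Certified VALUE `V ≤ Σ_b W‖p_b‖`, SLOPE
`|Σ_b segG W₁ p_b Δ 0| ≤ G‖Δ‖`, and CURVATURE-SUM floor `λ‖Δ‖² ≤ Σ_b segGd W₁ p_b Δ s` at the good parameters of the segment, `0 < λ`, give
`V − G²/(2λ) ≤ Σ_b W‖latPt U hexFrame b + U(hcpShift + ξ)‖` — for this `ξ`, hence (the data being uniform) for every `ξ` of the ball: ONE leaf per `U`-box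
covers the whole shuffle slab (memo C2-MEMO-hand-1-g26 §4 (C)). [folklore chaining: `sum_floor_of_curvature` + linearity of `U`] -/
theorem hcpShifted_floor_of_curvature (B : Finset (Fin 3 → ℤ)) (U : E3 →L[ℝ] E3) (ξ₀ ξ : E3) (hξ : U (ξ - ξ₀) ≠ 0)
    {W W₁ : ℝ → ℝ} (J : Finset ℝ) {a b lam G V : ℝ} (ha : 0 < a) (hlam : 0 < lam)
    (hW : ∀ r, a ≤ r → r ≤ b → HasDerivAt W (W₁ r) r) (hcont : ContinuousOn W₁ (Set.Icc a b))
    (hdiff : ∀ r, a < r → r < b → r ∉ J → HasDerivAt W₁ (deriv W₁ r) r)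
    (htube : ∀ bb ∈ B, ∀ s ∈ Set.Icc (0 : ℝ) 1,
      a ≤ ‖latPt U hexFrame bb + U (hcpShift + ξ₀) + s • U (ξ - ξ₀)‖ ∧ ‖latPt U hexFrame bb + U (hcpShift + ξ₀) + s • U (ξ - ξ₀)‖ ≤ b)
    (hcurv : ∀ s ∈ Set.Ioo (0 : ℝ) 1,
      (∀ bb ∈ B, a < segR (latPt U hexFrame bb + U (hcpShift + ξ₀)) (U (ξ - ξ₀)) s ∧
        segR (latPt U hexFrame bb + U (hcpShift + ξ₀)) (U (ξ - ξ₀)) s < b ∧ segR (latPt U hexFrame bb + U (hcpShift + ξ₀)) (U (ξ - ξ₀)) s ∉ J) →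
      lam * ‖U (ξ - ξ₀)‖ ^ 2 ≤ ∑ bb ∈ B, segGd W₁ (latPt U hexFrame bb + U (hcpShift + ξ₀)) (U (ξ - ξ₀)) s)
    (hV : V ≤ ∑ bb ∈ B, W ‖latPt U hexFrame bb + U (hcpShift + ξ₀)‖)
    (hG : |∑ bb ∈ B, segG W₁ (latPt U hexFrame bb + U (hcpShift + ξ₀)) (U (ξ - ξ₀)) 0| ≤ G * ‖U (ξ - ξ₀)‖) :
    V - G ^ 2 / (2 * lam) ≤ ∑ bb ∈ B, W ‖latPt U hexFrame bb + U (hcpShift + ξ)‖ := by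
  have key := sum_floor_of_curvature B (fun bb => latPt U hexFrame bb + U (hcpShift + ξ₀)) hξ J ha hlam hW hcont hdiff htube hcurv hV hG
  have hpt : ∀ bb : Fin 3 → ℤ, latPt U hexFrame bb + U (hcpShift + ξ₀) + U (ξ - ξ₀) = latPt U hexFrame bb + U (hcpShift + ξ) := by
    intro bb
    rw [add_assoc, ← map_add]
    congr 2
    abel
  simpa only [hpt] using key

end Summit.AtomisticToContinuum.Crystallization.Theorems.FrustratedLawDichotomyStrainedPatchHomConvexSegment

end
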